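import Mathlib
import Summits.Ventures.HodgeRepro2.T6N5Family

/-!
# T6N5Toy — non-vacuity witnesses for the N5 skeleton (README §10.5(ii)(c)/(d))

Tier 6 (README §10), sub-step N5 of the M2 discharge (t6-p7).  For every hypothesis structure of the
N5 skeleton files (`ToricSide` / `N5Data` of T6N5Skeleton, `GBranch.Hyps` of T6N5PropG) this file
exhibits a model instance on which ALL the hypotheses the assembly theorems consume hold JOINTLY —
the «toy/model instance» of the referees' joint-consistency protocol — and, for the Theorem 5.4 shape
`ToricSide.dichotomy`, a second instance on which the period VANISHES and (c) fails, so that the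
dichotomy Prop is satisfiable with either truth value of its left side (it forces nothing by itself).

* `toySide` / `toyData`: the trivial side (period ≠ 0, all signs +1, all central values 1, all
  characters trivial) — `dichotomy`, `levelReduction`, (a), (b), (c) hold; `toyData_N5 : toyData.N5`
  through `N5Data.N5_of`.
* `zeroSide`: period ≡ 0 and L(½, ξ_a) = 0 — `dichotomy` holds and `condC` fails (`zeroSide_not_condC`).
* `toyBranch : GBranch Unit ℕ ℚ`: the twist family ℕ (infinite), measure values 1, central values 1,
  no places dividing ℭ⁻, every μ-invariant 0, root number +1 — `toyBranch_hyps : toyBranch.Hyps`, hence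
  `CofiniteNonvanishing`, and `exists_twist_of_hyps` produces a twist.
* `toyFamily_N5 : ∃ ν, (toyFamily ν).N5` — the full assembly `N5Family.N5_of_propG` instantiated.

Nothing here is a display; nothing is claimed about the actual datum.  §8(d): uses an L-value-free
non-vanishing device: NO.
-/

namespace Summit.Ventures.HodgeRepro2.T6.N5Toy

open Summit.Ventures.HodgeRepro2.T6.N5Skeleton Summit.Ventures.HodgeRepro2.T6.N5PropG
  Summit.Ventures.HodgeRepro2.T6.N5Family

/-- The trivial side: period non-zero, trivial characters, all signs +1, central values 1. -/
def toySide : ToricSide Unit (Multiplicative ℤ) where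
  periodNonzero := True
  levelPeriodNonzero := True
  β := 1
  f := 1
  r := 1
  omega := fun _ _ => 1
  eps := fun _ _ => 1
  Lval := fun _ => 1

/-- (a) on the trivial side: 1 = 1 · 1. -/
theorem toySide_condA : toySide.condA := by
  simp [ToricSide.condA, toySide]

/-- (b) on the trivial side: every sign is +1. -/
theorem toySide_condB : toySide.condB := fun _ _ => rfl

/-- (c) on the trivial side: 1 · 1 ≠ 0. -/
theorem toySide_condC : toySide.condC := by
  simp [ToricSide.condC, toySide]

/-- Theorem 5.4's shape holds on the trivial side. -/
theorem toySide_dichotomy : toySide.dichotomy :=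
  ⟨fun _ => ⟨toySide_condA, toySide_condB, toySide_condC⟩, fun _ => trivial⟩

/-- N5.L1 on the trivial side (True → True). -/
theorem toySide_levelReduction : toySide.levelReduction := fun h => h

/-- The two-sided datum built from two copies of the trivial side. -/
def toyData : N5Data Unit (Multiplicative ℤ) where
  A := toySide
  B := toySide
  same_β := rfl
  same_f := rfl

/-- JOINT CONSISTENCY: every hypothesis of `N5Data.N5_of` holds on `toyData`, and N5 follows. -/
theorem toyData_N5 : toyData.N5 :=
  N5Data.N5_of toySide_dichotomy toySide_dichotomy toySide_levelReduction toySide_levelReduction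
    toySide_condA toySide_condA toySide_condB toySide_condB toySide_condC toySide_condC

/-- A side on which the period vanishes and (c) fails: Theorem 5.4's shape is satisfiable with a
FALSE left side (the dichotomy forces nothing). -/
def zeroSide : ToricSide Unit (Multiplicative ℤ) where
  periodNonzero := False
  levelPeriodNonzero := False
  β := 1
  f := 1
  r := 1
  omega := fun _ _ => 1
  eps := fun _ _ => 1
  Lval := fun _ => 0

/-- (c) FAILS on `zeroSide`: L(½, ξ_a) = 0. -/
theorem zeroSide_not_condC : ¬ zeroSide.condC := by
  simp [ToricSide.condC, zeroSide]

/-- Theorem 5.4's shape holds on `zeroSide` with a FALSE left side (the period vanishes and (c)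
fails) — the dichotomy Prop is satisfiable in both truth values of its left side. -/
theorem zeroSide_dichotomy : zeroSide.dichotomy :=
  ⟨fun h => h.elim, fun h => zeroSide_not_condC h.2.2⟩

/-- The trivial branch of Proposition G over the infinite twist family ℕ. -/
def toyBranch : GBranch Unit ℕ ℚ where
  L := fun _ => 1
  m := fun _ => 1
  inv := Equiv.refl ℕ
  condMinus := ∅
  muLoc := fun _ => 0
  muHsieh := 0
  muBH := 0
  muBHp := 0
  rootNumber := 1
  measureNeZero := True

/-- JOINT CONSISTENCY of `GBranch.Hyps`: every field holds on the trivial branch. -/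
theorem toyBranch_hyps : toyBranch.Hyps where
  hsieh := fun _ => by simp [toyBranch]
  local_finite := fun v hv => by simp [toyBranch] at hv
  sign := rfl
  twist := rfl
  bh := rfl
  nonzero := fun _ => trivial
  finite_of_nonzero := fun _ => by
    simp [T5PropGSkeleton.FinitelyManyZeros, toyBranch]
  interp := fun _ _ => one_ne_zero

/-- Proposition G (i) on the trivial branch (no zeros at all). -/
theorem toyBranch_cofinite : T5PropGSkeleton.CofiniteNonvanishing toyBranch.toBranchData :=
  GBranch.cofiniteNonvanishing toyBranch_hyps

/-- The constant twist family of trivial data. -/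
def toyFamily : ℕ → N5Data Unit (Multiplicative ℤ) := fun _ => toyData

/-- THE FULL ASSEMBLY on the toy: `N5Family.N5_of_propG` instantiated — all of its hypotheses hold
jointly on the model, and it delivers N5 for some member of the family. -/
theorem toyFamily_N5 : ∃ ν, (toyFamily ν).N5 :=
  N5_of_propG toyFamily Set.infinite_univ
    (fun _ => ⟨toySide_dichotomy, toySide_dichotomy⟩)
    (fun _ => ⟨toySide_levelReduction, toySide_levelReduction⟩)
    (fun _ => ⟨toySide_condA, toySide_condA⟩)
    (fun _ => ⟨toySide_condB, toySide_condB⟩)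
    (fun _ => toyBranch) (fun _ => toyBranch) (fun _ => toyBranch_hyps) (fun _ => toyBranch_hyps)
    (fun _ _ => rfl) (fun _ _ => rfl)

end Summit.Ventures.HodgeRepro2.T6.N5Toy
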